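import Literature.MathematicalPhysics.QuantumFieldTheory.Balaban1983to89.B12RTGaugeInvariance254
import Literature.MathematicalPhysics.QuantumFieldTheory.Balaban1983to89.B12SmallFieldDomain259
import Literature.MathematicalPhysics.QuantumFieldTheory.Balaban1983to89.T3AlphaInputsACTrivEnvelope

/-!
# E6′ ON FORESTS: the coarse bond variables of EVERY covariant block averaging are exact Haar singly, and exact product Haar
# over any family of coarse bonds that can be stripped leaf by leaf

Support file for `Summit.QuantumFields.YangMills.Theses.UnitScaleTilt.HistoryTailL` (stmt-QuantumFields-19936; fleet unit
ym-ust-18916-p1 g4, finding F-g4-1 `FINDING-19936-g4-E6prime.md`).  The located seam of that crux (stub 2‴ clause (e′), findings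
F-g3-3 / F-α1-11) and of `FluctuationComparisonRegPrL` stub 3′ (A) (F-g3-1) is EXACT HAAR COMPATIBILITY
`T3AlphaInputsACTrivEnvelope.HaarCompatT3 F` of the pinned block averaging: `Ū_*(dU) = dV`.  This file proves the part of it that
IS true, for EVERY averaging `av : Averaging P j G` (covariant in the standing range) with measurable `avg`, over every
`GaugeGroup` with bi-invariant probability `HaarData`:

* §1 (abstract, [folklore]) a finite measure on `G × Y` invariant under all LEFT (resp. RIGHT) translations of the first coordinate
  is `haar ⊗ (its Y-marginal)` (`eq_haar_prod_of_mapMulLeft`, `eq_haar_prod_of_mapMulRight`); a left-invariant probability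
  measure on `G` IS `haar` (`eq_haar_of_mapMulLeft`) — by convolution with the bi-invariant probability `haar`, no topology and no
  uniqueness theorem needed;
* §2 the law of `Ū = av.avg U`, `U ∼ dU`, is invariant under every COARSE gauge transformation (`map_gaugeAct_avg_eq`:
  `B12RTGaugeInvariance254.avg_gaugeAct_liftTransf` + `measurePreserving_gaugeAct`);
* §3 **single bond**: `(dU).map (U ↦ Ū(c)) = haar` for every coarse bond `c` (`map_avg_apply_eq_haar`);
  **leaf stripping**: for any measurable statistic `R` of the coarse field that does not feel gauge transformations at the
  site `c₋` (resp. `c₊`) — e.g. the restriction to any family of bonds avoiding that site — the pair `(Ū(c), R(Ū))` has law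
  `haar ⊗ law(R(Ū))` (`map_avg_pair_eq_haar_prod_of_src`, `…_of_tgt`, `map_avg_pair_eq_haar_prod_of_forall_ne_src`, `…_tgt`).
  Iterating along the leaves, the joint law over every FOREST of coarse bonds is exact product Haar; on an image torus of
  side ≥ 3 every PAIR of distinct coarse bond variables is independent Haar.
* §4 the instance at the pinned (0.4)/`ℰp` block averaging of a `T3Family` (the averaging of `HaarCompatT3`): every single coarse
  bond variable is exact Haar, pairs avoiding an endpoint are independent Haar (`T3.map_blockAvg_apply_eq_haar`,
  `T3.map_blockAvg_pair_eq_haar_prod_haar`) — the forest shadow of `HaarCompatT3 F`, unconditionally.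

HONEST FRAMING.  Elementary measure theory about the published covariance property ([Balaban1985Averaging] (11) p.19); it does
NOT decide `HaarCompatT3` (the coarse gauge group is not transitive on `G^{cycle}`: the classes of coarse-cycle holonomies are
exactly what is left undetermined — see the finding); nothing of Bałaban's estimates is asserted; not a claim about the mass gap.
-/

noncomputable section

namespace Summit.QuantumFields.YangMills.Theorems.HaarForest

open _root_.MeasureTheory
open Literature.MathematicalPhysics.QuantumFieldTheory.Balaban1983to89
open Literature.MathematicalPhysics.QuantumFieldTheory.Balaban1983to89.B12RTGaugeInvariance254
  (liftTransf avg_gaugeAct_liftTransf measurePreserving_gaugeAct measurable_gaugeAct)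

/-! ## §1 Left/right-invariant finite measures on `G × Y` are `haar ⊗ marginal` -/

section Abstract

variable {G : Type*} [GaugeGroup G] [MeasurableSpace G] [HaarData G] [MeasurableMul₂ G]
  {Y : Type*} [MeasurableSpace Y]

/-- `haar` gives every right translate of a measurable set the same mass. [folklore] -/
theorem haar_preimage_mul_right (h : G) {s : Set G} (hs : MeasurableSet s) :
    (HaarData.haar : Measure G) ((fun g => g * h) ⁻¹' s) = HaarData.haar s := by
  rw [← Measure.map_apply (measurable_mul_const h) hs, HaarData.map_mul_right]

/-- `haar` gives every left translate of a measurable set the same mass. [folklore] -/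
theorem haar_preimage_mul_left (h : G) {s : Set G} (hs : MeasurableSet s) :
    (HaarData.haar : Measure G) ((fun g => h * g) ⁻¹' s) = HaarData.haar s := by
  rw [← Measure.map_apply (measurable_const_mul h) hs, HaarData.map_mul_left]

omit [GaugeGroup G] [HaarData G] [MeasurableMul₂ G] in
/-- The indicator kernel `𝟙_s(a) · 𝟙_t(y)` used to average the invariance (measurable jointly). [folklore] -/
theorem measurable_indKernel {s : Set G} {t : Set Y} (hs : MeasurableSet s) (ht : MeasurableSet t)
    {Z : Type*} [MeasurableSpace Z] {a : Z → G} {y : Z → Y} (ha : Measurable a) (hy : Measurable y) :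
    Measurable fun z => s.indicator (1 : G → ENNReal) (a z) * t.indicator (1 : Y → ENNReal) (y z) :=
  ((measurable_const.indicator hs).comp ha).mul ((measurable_const.indicator ht).comp hy)

omit [GaugeGroup G] [HaarData G] [MeasurableMul₂ G] in
/-- `ν {p | a(p) ∈ s, p.2 ∈ t}` as the integral of the indicator kernel. [folklore] -/
theorem measure_setOf_eq_lintegral_indKernel (ν : Measure (G × Y)) {s : Set G} {t : Set Y} (hs : MeasurableSet s)
    (ht : MeasurableSet t) {a : G × Y → G} (ha : Measurable a) :
    ν {p | a p ∈ s ∧ p.2 ∈ t} = ∫⁻ p, s.indicator (1 : G → ENNReal) (a p) * t.indicator (1 : Y → ENNReal) p.2 ∂ν := by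
  have hset : {p : G × Y | a p ∈ s ∧ p.2 ∈ t} = a ⁻¹' s ∩ Prod.snd ⁻¹' t := rfl
  rw [hset, ← lintegral_indicator_one ((hs.preimage ha).inter (ht.preimage measurable_snd))]
  refine lintegral_congr fun p => ?_
  by_cases h1 : a p ∈ s <;> by_cases h2 : p.2 ∈ t <;> simp [h1, h2]

omit [GaugeGroup G] [HaarData G] [MeasurableMul₂ G] in
/-- `∫ 𝟙_t(p.2) dν = ν (G × t)`. [folklore] -/
theorem lintegral_indicator_snd (ν : Measure (G × Y)) {t : Set Y} (ht : MeasurableSet t) :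
    ∫⁻ p, t.indicator (1 : Y → ENNReal) p.2 ∂ν = ν (Set.univ ×ˢ t) := by
  rw [Set.univ_prod, ← lintegral_indicator_one (ht.preimage measurable_snd)]
  refine lintegral_congr fun p => ?_
  by_cases h2 : p.2 ∈ t <;> simp [h2]

/-- Rectangle identity for a LEFT-invariant finite measure on `G × Y`: `ν (s × t) = haar s · ν (G × t)` (average the
invariance over `g ∼ haar`, swap the integrals, use RIGHT invariance of `haar`). [folklore] -/
theorem prod_apply_eq_haar_mul_of_mapMulLeft (ν : Measure (G × Y)) [IsFiniteMeasure ν]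
    (hν : ∀ g : G, ν.map (fun p : G × Y => (g * p.1, p.2)) = ν) {s : Set G} {t : Set Y}
    (hs : MeasurableSet s) (ht : MeasurableSet t) :
    ν (s ×ˢ t) = HaarData.haar s * ν (Set.univ ×ˢ t) := by
  have hTg : ∀ g : G, Measurable (fun p : G × Y => (g * p.1, p.2)) :=
    fun g => (measurable_fst.const_mul g).prodMk measurable_snd
  have h1 : ∀ g : G, ν (s ×ˢ t) =
      ∫⁻ p, s.indicator (1 : G → ENNReal) (g * p.1) * t.indicator (1 : Y → ENNReal) p.2 ∂ν := by
    intro g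
    conv_lhs => rw [← hν g]
    rw [Measure.map_apply (hTg g) (hs.prod ht),
      ← measure_setOf_eq_lintegral_indKernel ν hs ht (measurable_fst.const_mul g)]
    rfl
  have h2 : ν (s ×ˢ t) = ∫⁻ g, ∫⁻ p, s.indicator (1 : G → ENNReal) (g * p.1) * t.indicator (1 : Y → ENNReal) p.2 ∂ν
      ∂(HaarData.haar : Measure G) := by
    rw [lintegral_congr fun g => (h1 g).symm, lintegral_const, measure_univ, mul_one]
  rw [h2, lintegral_lintegral_swap
    (measurable_indKernel hs ht (measurable_fst.mul (measurable_fst.comp measurable_snd))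
      (measurable_snd.comp measurable_snd)).aemeasurable]
  have h3 : ∀ p : G × Y, ∫⁻ g, s.indicator (1 : G → ENNReal) (g * p.1) * t.indicator (1 : Y → ENNReal) p.2
      ∂(HaarData.haar : Measure G) = HaarData.haar s * t.indicator (1 : Y → ENNReal) p.2 := by
    intro p
    rw [lintegral_mul_const _ (show Measurable (fun g : G => s.indicator (1 : G → ENNReal) (g * p.1)) from
        (measurable_const.indicator hs).comp (measurable_mul_const p.1)),
      ← haar_preimage_mul_right p.1 hs, ← lintegral_indicator_one ((measurable_mul_const p.1) hs)]
    congr 1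
  rw [lintegral_congr h3, lintegral_const_mul _ (show Measurable (fun p : G × Y => t.indicator (1 : Y → ENNReal) p.2) from
      (measurable_const.indicator ht).comp measurable_snd),
    lintegral_indicator_snd ν ht]

/-- Rectangle identity for a RIGHT-invariant finite measure on `G × Y`: `ν (s × t) = haar s · ν (G × t)` (LEFT invariance of
`haar`). [folklore] -/
theorem prod_apply_eq_haar_mul_of_mapMulRight (ν : Measure (G × Y)) [IsFiniteMeasure ν]
    (hν : ∀ g : G, ν.map (fun p : G × Y => (p.1 * g, p.2)) = ν) {s : Set G} {t : Set Y}
    (hs : MeasurableSet s) (ht : MeasurableSet t) :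
    ν (s ×ˢ t) = HaarData.haar s * ν (Set.univ ×ˢ t) := by
  have hTg : ∀ g : G, Measurable (fun p : G × Y => (p.1 * g, p.2)) :=
    fun g => (measurable_fst.mul_const g).prodMk measurable_snd
  have h1 : ∀ g : G, ν (s ×ˢ t) =
      ∫⁻ p, s.indicator (1 : G → ENNReal) (p.1 * g) * t.indicator (1 : Y → ENNReal) p.2 ∂ν := by
    intro g
    conv_lhs => rw [← hν g]
    rw [Measure.map_apply (hTg g) (hs.prod ht),
      ← measure_setOf_eq_lintegral_indKernel ν hs ht (measurable_fst.mul_const g)]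
    rfl
  have h2 : ν (s ×ˢ t) = ∫⁻ g, ∫⁻ p, s.indicator (1 : G → ENNReal) (p.1 * g) * t.indicator (1 : Y → ENNReal) p.2 ∂ν
      ∂(HaarData.haar : Measure G) := by
    rw [lintegral_congr fun g => (h1 g).symm, lintegral_const, measure_univ, mul_one]
  rw [h2, lintegral_lintegral_swap
    (measurable_indKernel hs ht ((measurable_fst.comp measurable_snd).mul measurable_fst)
      (measurable_snd.comp measurable_snd)).aemeasurable]
  have h3 : ∀ p : G × Y, ∫⁻ g, s.indicator (1 : G → ENNReal) (p.1 * g) * t.indicator (1 : Y → ENNReal) p.2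
      ∂(HaarData.haar : Measure G) = HaarData.haar s * t.indicator (1 : Y → ENNReal) p.2 := by
    intro p
    rw [lintegral_mul_const _ (show Measurable (fun g : G => s.indicator (1 : G → ENNReal) (p.1 * g)) from
        (measurable_const.indicator hs).comp (measurable_const_mul p.1)),
      ← haar_preimage_mul_left p.1 hs, ← lintegral_indicator_one ((measurable_const_mul p.1) hs)]
    congr 1
  rw [lintegral_congr h3, lintegral_const_mul _ (show Measurable (fun p : G × Y => t.indicator (1 : Y → ENNReal) p.2) from
      (measurable_const.indicator ht).comp measurable_snd),
    lintegral_indicator_snd ν ht]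

/-- **A finite measure on `G × Y` invariant under all left translations of the `G`-coordinate is `haar ⊗ (its `Y`-marginal)`.** [folklore] -/
theorem eq_haar_prod_of_mapMulLeft (ν : Measure (G × Y)) [IsFiniteMeasure ν]
    (hν : ∀ g : G, ν.map (fun p : G × Y => (g * p.1, p.2)) = ν) :
    ν = (HaarData.haar : Measure G).prod (ν.map Prod.snd) := by
  refine (Measure.prod_eq fun s t hs ht => ?_).symm
  rw [prod_apply_eq_haar_mul_of_mapMulLeft ν hν hs ht, Measure.map_apply measurable_snd ht, ← Set.univ_prod]

/-- **A finite measure on `G × Y` invariant under all right translations of the `G`-coordinate is `haar ⊗ (its `Y`-marginal)`.** [folklore] -/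
theorem eq_haar_prod_of_mapMulRight (ν : Measure (G × Y)) [IsFiniteMeasure ν]
    (hν : ∀ g : G, ν.map (fun p : G × Y => (p.1 * g, p.2)) = ν) :
    ν = (HaarData.haar : Measure G).prod (ν.map Prod.snd) := by
  refine (Measure.prod_eq fun s t hs ht => ?_).symm
  rw [prod_apply_eq_haar_mul_of_mapMulRight ν hν hs ht, Measure.map_apply measurable_snd ht, ← Set.univ_prod]

/-- **A left-invariant probability measure on `G` IS `haar`** (uniqueness from bi-invariance of the probability `haar` alone:
`ν = haar ∗ ν = haar`). [folklore] -/
theorem eq_haar_of_mapMulLeft (ν : Measure G) [IsProbabilityMeasure ν] (hν : ∀ g : G, ν.map (fun x => g * x) = ν) :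
    ν = HaarData.haar := by
  -- lift to `G × Unit` and read off the first marginal
  set ν' : Measure (G × Unit) := ν.map (fun x => (x, ())) with hν'
  have hmeas : Measurable (fun x : G => (x, ())) := measurable_id.prodMk measurable_const
  haveI : IsFiniteMeasure ν' := by rw [hν']; infer_instance
  have hinv : ∀ g : G, ν'.map (fun p : G × Unit => (g * p.1, p.2)) = ν' := by
    intro g
    rw [hν', Measure.map_map ((measurable_fst.const_mul g).prodMk measurable_snd) hmeas]
    have : (fun p : G × Unit => (g * p.1, p.2)) ∘ (fun x : G => (x, ())) = (fun x : G => (x, ())) ∘ fun x => g * x := rfl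
    rw [this, ← Measure.map_map hmeas (measurable_const_mul g), hν g]
  have key := eq_haar_prod_of_mapMulLeft ν' hinv
  have hfst : ν'.map Prod.fst = ν := by
    rw [hν', Measure.map_map measurable_fst hmeas]
    exact Measure.map_id
  calc ν = ν'.map Prod.fst := hfst.symm
    _ = ((HaarData.haar : Measure G).prod (ν'.map Prod.snd)).map Prod.fst := by rw [← key]
    _ = HaarData.haar := by
        rw [Measure.map_fst_prod]
        have : (ν'.map Prod.snd) Set.univ = 1 := by
          rw [hν', Measure.map_map measurable_snd hmeas, Measure.map_apply (measurable_snd.comp hmeas) MeasurableSet.univ]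
          simp
        rw [this, one_smul]

/-- **A right-invariant probability measure on `G` IS `haar`.** [folklore] -/
theorem eq_haar_of_mapMulRight (ν : Measure G) [IsProbabilityMeasure ν] (hν : ∀ g : G, ν.map (fun x => x * g) = ν) :
    ν = HaarData.haar := by
  set ν' : Measure (G × Unit) := ν.map (fun x => (x, ())) with hν'
  have hmeas : Measurable (fun x : G => (x, ())) := measurable_id.prodMk measurable_const
  haveI : IsFiniteMeasure ν' := by rw [hν']; infer_instance
  have hinv : ∀ g : G, ν'.map (fun p : G × Unit => (p.1 * g, p.2)) = ν' := by
    intro g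
    rw [hν', Measure.map_map ((measurable_fst.mul_const g).prodMk measurable_snd) hmeas]
    have : (fun p : G × Unit => (p.1 * g, p.2)) ∘ (fun x : G => (x, ())) = (fun x : G => (x, ())) ∘ fun x => x * g := rfl
    rw [this, ← Measure.map_map hmeas (measurable_mul_const g), hν g]
  have key := eq_haar_prod_of_mapMulRight ν' hinv
  have hfst : ν'.map Prod.fst = ν := by
    rw [hν', Measure.map_map measurable_fst hmeas]
    exact Measure.map_id
  calc ν = ν'.map Prod.fst := hfst.symm
    _ = ((HaarData.haar : Measure G).prod (ν'.map Prod.snd)).map Prod.fst := by rw [← key]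
    _ = HaarData.haar := by
        rw [Measure.map_fst_prod]
        have : (ν'.map Prod.snd) Set.univ = 1 := by
          rw [hν', Measure.map_map measurable_snd hmeas, Measure.map_apply (measurable_snd.comp hmeas) MeasurableSet.univ]
          simp
        rw [this, one_smul]

end Abstract

/-! ## §2 The law of `Ū` is invariant under coarse gauge transformations -/

section Gauge

variable {P : Params} {j : ℕ} {G : Type*} [GaugeGroup G] [MeasurableSpace G] [HaarData G] [MeasurableMul₂ G]

omit [MeasurableSpace G] [HaarData G] [MeasurableMul₂ G] in
/-- The coarse gauge transformation equal to `g` at one site and `1` elsewhere, acting on a bond variable. [folklore] -/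
theorem gaugeAct_update_apply (z : Site P (j+1)) (g : G) (V : GaugeField P (j+1) G) (b : PBond P (j+1)) :
    GaugeField.gaugeAct (Function.update (fun _ => (1 : G)) z g) V b =
      (if b.src = z then g else 1) * V b * (if b.tgt = z then g else 1)⁻¹ := by
  simp only [GaugeField.gaugeAct, Function.update_apply]

omit [MeasurableSpace G] [HaarData G] [MeasurableMul₂ G] in
/-- At the bond `c` itself the transformation concentrated at `c₋` is LEFT multiplication by `g` (`c₋ ≠ c₊`). [folklore] -/
theorem gaugeAct_update_src_self (c : PBond P (j+1)) (g : G) (V : GaugeField P (j+1) G) :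
    GaugeField.gaugeAct (Function.update (fun _ => (1 : G)) c.src g) V c = g * V c := by
  rw [gaugeAct_update_apply, if_pos rfl, if_neg (B12SmallFieldDomain259.src_ne_tgt c).symm, inv_one, mul_one]

omit [MeasurableSpace G] [HaarData G] [MeasurableMul₂ G] in
/-- At the bond `c` itself the transformation concentrated at `c₊` is RIGHT multiplication by `g⁻¹`. [folklore] -/
theorem gaugeAct_update_tgt_self (c : PBond P (j+1)) (g : G) (V : GaugeField P (j+1) G) :
    GaugeField.gaugeAct (Function.update (fun _ => (1 : G)) c.tgt g) V c = V c * g⁻¹ := by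
  rw [gaugeAct_update_apply, if_neg (B12SmallFieldDomain259.src_ne_tgt c), if_pos rfl, one_mul]

omit [MeasurableSpace G] [HaarData G] [MeasurableMul₂ G] in
/-- A bond avoiding the site `z` does not feel the transformation concentrated at `z`. [folklore] -/
theorem gaugeAct_update_of_ne {z : Site P (j+1)} (g : G) (V : GaugeField P (j+1) G) {b : PBond P (j+1)}
    (hs : b.src ≠ z) (ht : b.tgt ≠ z) :
    GaugeField.gaugeAct (Function.update (fun _ => (1 : G)) z g) V b = V b := by
  rw [gaugeAct_update_apply, if_neg hs, if_neg ht, inv_one, one_mul, mul_one]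

variable (hj : j + 1 ≤ P.m + P.K) (av : Averaging P j G) (hav : Measurable av.avg)
include hj hav

/-- **The law of `Ū = av.avg U` under `dU` is invariant under every coarse gauge transformation `v`**: for every measurable
statistic `F`, `F(Ū^v)` and `F(Ū)` have the same law (covariance `Ū(U^{v∘blockOf}) = (ŪU)^v` + gauge invariance of `dU`).
[cite: Balaban1985Averaging, (11) p.19] -/
theorem map_gaugeAct_avg_eq {X : Type*} [MeasurableSpace X] (F : GaugeField P (j+1) G → X) (hF : Measurable F)
    (v : GaugeTransf P (j+1) G) :
    (fieldMeasure P j G).map (fun U => F (GaugeField.gaugeAct v (av.avg U))) =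
      (fieldMeasure P j G).map (fun U => F (av.avg U)) := by
  have hfun : (fun U => F (GaugeField.gaugeAct v (av.avg U))) =
      (fun U => F (av.avg U)) ∘ GaugeField.gaugeAct (liftTransf v) := by
    funext U
    simp only [Function.comp_apply, avg_gaugeAct_liftTransf hj av v U]
  have hmeas : Measurable (fun U : GaugeField P j G => F (av.avg U)) := hF.comp hav
  rw [hfun, ← Measure.map_map hmeas (measurable_gaugeAct _), (measurePreserving_gaugeAct (liftTransf v)).map_eq]

/-! ## §3 Single coarse bonds are exact Haar; leaf stripping -/

/-- **E6′ FOR ONE BOND: the coarse bond variable `Ū(c)` of EVERY covariant measurable averaging is EXACTLY Haar distributed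
under `dU`**, at every level of the standing range, for every coarse bond `c`. [cite: Balaban1985Averaging, (11) p.19] -/
theorem map_avg_apply_eq_haar (c : PBond P (j+1)) :
    (fieldMeasure P j G).map (fun U => av.avg U c) = HaarData.haar := by
  have hmc : Measurable (fun U : GaugeField P j G => av.avg U c) := (measurable_pi_apply c).comp hav
  haveI : IsProbabilityMeasure ((fieldMeasure P j G).map (fun U => av.avg U c)) :=
    Measure.isProbabilityMeasure_map hmc.aemeasurable
  refine eq_haar_of_mapMulLeft _ fun g => ?_
  rw [Measure.map_map (measurable_const_mul g) hmc]
  have hfun : ((fun x => g * x) ∘ fun U : GaugeField P j G => av.avg U c) =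
      fun U => (fun V : GaugeField P (j+1) G => V c)
        (GaugeField.gaugeAct (Function.update (fun _ => (1 : G)) c.src g) (av.avg U)) := by
    funext U
    simp only [Function.comp_apply, gaugeAct_update_src_self]
  have hVc : Measurable fun V : GaugeField P (j+1) G => V c := measurable_pi_apply c
  rw [hfun, map_gaugeAct_avg_eq hj av hav (fun V => V c) hVc]

/-- **LEAF STRIPPING AT `c₋`**: for any measurable statistic `R` of the coarse field that does not feel gauge transformations
concentrated at the site `c₋`, the pair `(Ū(c), R(Ū))` has law `haar ⊗ law(R(Ū))` — `Ū(c)` is Haar and INDEPENDENT of `R(Ū)`.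
[cite: Balaban1985Averaging, (11) p.19] -/
theorem map_avg_pair_eq_haar_prod_of_src (c : PBond P (j+1)) {Y : Type*} [MeasurableSpace Y]
    (R : GaugeField P (j+1) G → Y) (hR : Measurable R)
    (hRinv : ∀ (g : G) (V : GaugeField P (j+1) G),
      R (GaugeField.gaugeAct (Function.update (fun _ => (1 : G)) c.src g) V) = R V) :
    (fieldMeasure P j G).map (fun U => (av.avg U c, R (av.avg U))) =
      (HaarData.haar : Measure G).prod ((fieldMeasure P j G).map (fun U => R (av.avg U))) := by
  have hmc : Measurable (fun U : GaugeField P j G => av.avg U c) := (measurable_pi_apply c).comp hav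
  have hmR : Measurable (fun U : GaugeField P j G => R (av.avg U)) := hR.comp hav
  have hpair : Measurable (fun U : GaugeField P j G => (av.avg U c, R (av.avg U))) := hmc.prodMk hmR
  haveI : IsFiniteMeasure ((fieldMeasure P j G).map (fun U => (av.avg U c, R (av.avg U)))) := by infer_instance
  have key := eq_haar_prod_of_mapMulLeft ((fieldMeasure P j G).map (fun U => (av.avg U c, R (av.avg U)))) fun g => by
    rw [Measure.map_map ((measurable_fst.const_mul g).prodMk measurable_snd) hpair]
    have hfun : ((fun p : G × Y => (g * p.1, p.2)) ∘ fun U : GaugeField P j G => (av.avg U c, R (av.avg U))) =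
        fun U => (fun V : GaugeField P (j+1) G => (V c, R V))
          (GaugeField.gaugeAct (Function.update (fun _ => (1 : G)) c.src g) (av.avg U)) := by
      funext U
      simp only [Function.comp_apply, gaugeAct_update_src_self, hRinv]
    have hVc : Measurable fun V : GaugeField P (j+1) G => V c := measurable_pi_apply c
    rw [hfun, map_gaugeAct_avg_eq hj av hav (fun V => (V c, R V)) (hVc.prodMk hR)]
  rw [key, Measure.map_map measurable_snd hpair]
  rfl

/-- **LEAF STRIPPING AT `c₊`** (right translations). [cite: Balaban1985Averaging, (11) p.19] -/
theorem map_avg_pair_eq_haar_prod_of_tgt (c : PBond P (j+1)) {Y : Type*} [MeasurableSpace Y]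
    (R : GaugeField P (j+1) G → Y) (hR : Measurable R)
    (hRinv : ∀ (g : G) (V : GaugeField P (j+1) G),
      R (GaugeField.gaugeAct (Function.update (fun _ => (1 : G)) c.tgt g) V) = R V) :
    (fieldMeasure P j G).map (fun U => (av.avg U c, R (av.avg U))) =
      (HaarData.haar : Measure G).prod ((fieldMeasure P j G).map (fun U => R (av.avg U))) := by
  have hmc : Measurable (fun U : GaugeField P j G => av.avg U c) := (measurable_pi_apply c).comp hav
  have hmR : Measurable (fun U : GaugeField P j G => R (av.avg U)) := hR.comp hav
  have hpair : Measurable (fun U : GaugeField P j G => (av.avg U c, R (av.avg U))) := hmc.prodMk hmR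
  haveI : IsFiniteMeasure ((fieldMeasure P j G).map (fun U => (av.avg U c, R (av.avg U)))) := by infer_instance
  have key := eq_haar_prod_of_mapMulRight ((fieldMeasure P j G).map (fun U => (av.avg U c, R (av.avg U)))) fun g => by
    rw [Measure.map_map ((measurable_fst.mul_const g).prodMk measurable_snd) hpair]
    have hfun : ((fun p : G × Y => (p.1 * g, p.2)) ∘ fun U : GaugeField P j G => (av.avg U c, R (av.avg U))) =
        fun U => (fun V : GaugeField P (j+1) G => (V c, R V))
          (GaugeField.gaugeAct (Function.update (fun _ => (1 : G)) c.tgt g⁻¹) (av.avg U)) := by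
      funext U
      simp only [Function.comp_apply, gaugeAct_update_tgt_self, hRinv, inv_inv]
    have hVc : Measurable fun V : GaugeField P (j+1) G => V c := measurable_pi_apply c
    rw [hfun, map_gaugeAct_avg_eq hj av hav (fun V => (V c, R V)) (hVc.prodMk hR)]
  rw [key, Measure.map_map measurable_snd hpair]
  rfl

/-- **FOREST STEP (family form, leaf at `c₋`)**: if no bond of the family `e` touches the site `c₋`, then `Ū(c)` is Haar and
independent of `(Ū(e i))_i`: `law(Ū(c), (Ū(e i))_i) = haar ⊗ law((Ū(e i))_i)`.  Iterating (strip a leaf, recurse on the rest)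
gives exact product Haar over every forest of coarse bonds. [cite: Balaban1985Averaging, (11) p.19] -/
theorem map_avg_pair_eq_haar_prod_of_forall_ne_src (c : PBond P (j+1)) {ι : Type*} [Countable ι] (e : ι → PBond P (j+1))
    (he : ∀ i, (e i).src ≠ c.src ∧ (e i).tgt ≠ c.src) :
    (fieldMeasure P j G).map (fun U => (av.avg U c, fun i => av.avg U (e i))) =
      (HaarData.haar : Measure G).prod ((fieldMeasure P j G).map (fun U i => av.avg U (e i))) := by
  have hR : Measurable fun (V : GaugeField P (j+1) G) (i : ι) => V (e i) :=
    measurable_pi_lambda _ fun i => (measurable_pi_apply (e i) : Measurable fun V : GaugeField P (j+1) G => V (e i))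
  exact map_avg_pair_eq_haar_prod_of_src hj av hav c (fun V i => V (e i)) hR
    fun g V => funext fun i => gaugeAct_update_of_ne g V (he i).1 (he i).2

/-- **FOREST STEP (family form, leaf at `c₊`)**. [cite: Balaban1985Averaging, (11) p.19] -/
theorem map_avg_pair_eq_haar_prod_of_forall_ne_tgt (c : PBond P (j+1)) {ι : Type*} [Countable ι] (e : ι → PBond P (j+1))
    (he : ∀ i, (e i).src ≠ c.tgt ∧ (e i).tgt ≠ c.tgt) :
    (fieldMeasure P j G).map (fun U => (av.avg U c, fun i => av.avg U (e i))) =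
      (HaarData.haar : Measure G).prod ((fieldMeasure P j G).map (fun U i => av.avg U (e i))) := by
  have hR : Measurable fun (V : GaugeField P (j+1) G) (i : ι) => V (e i) :=
    measurable_pi_lambda _ fun i => (measurable_pi_apply (e i) : Measurable fun V : GaugeField P (j+1) G => V (e i))
  exact map_avg_pair_eq_haar_prod_of_tgt hj av hav c (fun V i => V (e i)) hR
    fun g V => funext fun i => gaugeAct_update_of_ne g V (he i).1 (he i).2

/-- **PAIRS**: two coarse bonds `c ≠ c′` such that `c′` avoids one endpoint of `c` (always the case on an image torus of side
≥ 3) carry INDEPENDENT Haar variables: `law(Ū(c), Ū(c′)) = haar ⊗ haar`. [cite: Balaban1985Averaging, (11) p.19] -/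
theorem map_avg_pair_eq_haar_prod_haar (c c' : PBond P (j+1)) (hs : c'.src ≠ c.src) (ht : c'.tgt ≠ c.src) :
    (fieldMeasure P j G).map (fun U => (av.avg U c, av.avg U c')) =
      (HaarData.haar : Measure G).prod (HaarData.haar : Measure G) := by
  have hVc' : Measurable fun V : GaugeField P (j+1) G => V c' := measurable_pi_apply c'
  rw [map_avg_pair_eq_haar_prod_of_src hj av hav c (fun V => V c') hVc'
      (fun g V => gaugeAct_update_of_ne g V hs ht), map_avg_apply_eq_haar hj av hav c']

end Gauge

/-! ## §4 The pinned averaging of the `T3Family`: the forest shadow of `HaarCompatT3` -/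

namespace T3

open Literature.MathematicalPhysics.QuantumFieldTheory.Balaban1983to89.T3ContinuumYM3Torus
open Literature.MathematicalPhysics.QuantumFieldTheory.Balaban1983to89.T3UnitLawDensityEML (ℰp measurable_blockAvg)

/-- **SINGLE-BOND SHADOW OF `HaarCompatT3 F`, UNCONDITIONALLY**: under the product Haar measure of level `j` of the `K`-th
approximation, every coarse bond variable of Bałaban's (0.4)/`ℰp` block averaging is EXACTLY Haar distributed on `SU(2)`
(standing range `j + 1 ≤ m + K`). [cite: Balaban1985Averaging, (11) p.19] -/
theorem map_blockAvg_apply_eq_haar (F : T3Family) (K j : ℕ) (hj : j + 1 ≤ F.m + K)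
    (c : PBond (F.P K) (j + 1)) :
    (fieldMeasure (F.P K) j (Matrix.specialUnitaryGroup (Fin 2) ℂ)).map
        (fun U => (BlockAveraging.blockAvg (P := F.P K) (j := j) ℰp).avg U c) = HaarData.haar :=
  map_avg_apply_eq_haar (P := F.P K) hj _ (measurable_blockAvg F K j) c

/-- **PAIR SHADOW OF `HaarCompatT3 F`, UNCONDITIONALLY**: two coarse bond variables of the (0.4)/`ℰp` block averaging such that
the second bond avoids the source of the first (every pair of distinct bonds on an image torus of side ≥ 3) are INDEPENDENT and
Haar. [cite: Balaban1985Averaging, (11) p.19] -/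
theorem map_blockAvg_pair_eq_haar_prod_haar (F : T3Family) (K j : ℕ) (hj : j + 1 ≤ F.m + K)
    (c c' : PBond (F.P K) (j + 1)) (hs : c'.src ≠ c.src) (ht : c'.tgt ≠ c.src) :
    (fieldMeasure (F.P K) j (Matrix.specialUnitaryGroup (Fin 2) ℂ)).map
        (fun U => ((BlockAveraging.blockAvg (P := F.P K) (j := j) ℰp).avg U c,
          (BlockAveraging.blockAvg (P := F.P K) (j := j) ℰp).avg U c')) =
      (HaarData.haar : Measure (Matrix.specialUnitaryGroup (Fin 2) ℂ)).prod HaarData.haar :=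
  map_avg_pair_eq_haar_prod_haar (P := F.P K) hj _ (measurable_blockAvg F K j) c c' hs ht

end T3

end Summit.QuantumFields.YangMills.Theorems.HaarForest

end
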